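import Summits.BirchSwinnertonDyer.BirchSwinnertonDyer.Theorems.EdixhovenFibreFiveSevenStarredOptimalManinUnitFiveSevenHcorPrimeSquare
import Literature.NumberTheory.Automorphic.UnboundedDenominatorsInvariantHomPrimePow
import HarnessLib

set_option autoImplicit false
-- the sub-problem namespace `Summit.BirchSwinnertonDyer.BirchSwinnertonDyer` duplicates a component by design (D-0017)
set_option linter.dupNamespace false

/-!
# K★ line `cdt_thm1`, stub `stub_hcor_invariant`: all levels not divisible by `4`

Crux `StarredOptimalManinUnitFiveSeven` (stmt-BirchSwinnertonDyer-22226); skeleton v17 has the single stub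
`stub_hcor_invariant` (all `N`).  With the depth step at odd prime powers
(`UnboundedDenominatorsInvariantHomPrimePow.map_eq_one_of_mem_commutator_top_layer`: the `p`-part of the
Schur multiplier of `SL₂(ℤ/p^e)` vanishes for odd `p`, all `e`), the transfer step and the squarefree /
`p²` levels, this file proves:

* `cor453_invariant_form_exponent_of_not_four_dvd` — `Q` of exponent `ℓ^a`, `4 ∤ N` (if `ℓ = 2`): every
  `SL₂(ℤ)`-invariant `θ : Γ(N) → Q` kills `Γ(12N)` (strong induction on `N`; the depth step uses the induction
  hypothesis at level `N/ℓ` through the universal invariant homomorphism);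
* `cor453_invariant_form_of_not_four_dvd` — **for every `N ≥ 1` with `4 ∤ N` and every finite commutative `Q`,
  every `SL₂(ℤ)`-invariant `θ : Γ(N) → Q` is trivial on `Γ(12N)`**; `stub_hcor_invariant_of_not_four_dvd`
  (the stub's exact shape for such `N`); `Gamma_mul_le_commutator_of_not_four_dvd : Γ(12N) ≤ [SL₂(ℤ), Γ(N)]`.

What is left of the stub: the levels with `4 ∣ N` (the genuine `ℤ/2` in the Schur multiplier of
`SL₂(ℤ/2^e)`, `e ≥ 2`, [Beyl1986]).  K★ / Manin / BSD are not proved.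
-/

open scoped MatrixGroups commutatorElement

namespace Summit.BirchSwinnertonDyer.BirchSwinnertonDyer.Theorems

namespace HcorPrimePow

open CongruenceSubgroup Matrix.SpecialLinearGroup ModularGroup
open Literature.NumberTheory.Automorphic.UnboundedDenominators

/-- `Γ(L) ≤ Γ(M)` for `M ∣ L`. [folklore] -/
private theorem Gamma_le_Gamma_of_dvd₁₂ {M L : ℕ} (h : M ∣ L) : Gamma L ≤ Gamma M := by
  intro γ hγ
  obtain ⟨h00, h01, h10, h11⟩ := Gamma_mem.mp hγ
  have cast_eq : ∀ a : ℤ, ((a : ZMod L).cast : ZMod M) = (a : ZMod M) := fun a ↦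
    ZMod.cast_intCast h a
  rw [Gamma_mem]
  refine ⟨?_, ?_, ?_, ?_⟩
  · rw [← cast_eq, h00, ZMod.cast_one h]
  · rw [← cast_eq, h01, ZMod.cast_zero]
  · rw [← cast_eq, h10, ZMod.cast_zero]
  · rw [← cast_eq, h11, ZMod.cast_one h]

/-- The transfer step with the level as a variable. [cite: CalegariDimitrovTang2025, Corollary 4.5.3] -/
private theorem transfer_step₄ {Q : Type*} [CommGroup Q] {N M p e M₀ : ℕ} [NeZero M] (hN : N = M * p)
    (hp : p.Prime) (hpM : p ∣ M) (hcop : e.Coprime p) (hQ : ∀ q : Q, q ^ e = 1)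
    (hM : ∀ ψ : Gamma M →* Q,
      (∀ (g x : SL(2, ℤ)) (hx : x ∈ Gamma M) (hgx : g * x * g⁻¹ ∈ Gamma M),
        ψ ⟨g * x * g⁻¹, hgx⟩ = ψ ⟨x, hx⟩) →
      ∀ (x : SL(2, ℤ)) (hx : x ∈ Gamma M), x ∈ Gamma M₀ → ψ ⟨x, hx⟩ = 1)
    (θ : Gamma N →* Q)
    (hθ : ∀ (g x : SL(2, ℤ)) (hx : x ∈ Gamma N) (hgx : g * x * g⁻¹ ∈ Gamma N),
      θ ⟨g * x * g⁻¹, hgx⟩ = θ ⟨x, hx⟩) :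
    ∀ (x : SL(2, ℤ)) (hx : x ∈ Gamma N), x ∈ Gamma M₀ → θ ⟨x, hx⟩ = 1 := by
  subst hN
  exact map_eq_one_of_transfer_step hp hpM hcop hQ hM θ hθ

/-- The depth step with the level as a variable. [cite: CalegariDimitrovTang2025, Corollary 4.5.3] -/
private theorem top_layer' {Q : Type*} [CommGroup Q] {N p m' n a : ℕ} (hN : N = m' * p ^ (n + 2))
    (hp : p.Prime) (hp2 : p ≠ 2) [NeZero m'] (hmm : m'.Coprime p) (θ : Gamma N →* Q)
    (hθ : ∀ (g x : SL(2, ℤ)) (hx : x ∈ Gamma N) (hgx : g * x * g⁻¹ ∈ Gamma N),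
      θ ⟨g * x * g⁻¹, hgx⟩ = θ ⟨x, hx⟩)
    (he : ∀ x : Gamma N, θ x ^ (p ^ a) = 1) :
    ∀ (y : SL(2, ℤ)) (hy : y ∈ Gamma N),
      y ∈ ⁅(⊤ : Subgroup SL(2, ℤ)), Gamma (m' * p ^ (n + 1))⁆ ⊔ θ.ker.map (Gamma N).subtype →
      θ ⟨y, hy⟩ = 1 := by
  subst hN
  exact map_eq_one_of_mem_commutator_top_layer hp hp2 hmm θ hθ he

/-- **`∃ k` prime to `ℓ` with `x^k ∈ [SL₂(ℤ), Γ(M)]` for `x ∈ Γ(12M)`**, from the invariant form at level `M`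
for all targets of `ℓ`-power exponent (universal invariant homomorphism, `ℓ`-primary corestriction).
[cite: CalegariDimitrovTang2025, Corollary 4.5.3] -/
theorem exists_pow_mem_commutator_of_forall {ℓ M : ℕ} (hℓ : ℓ.Prime) (hM0 : M ≠ 0)
    (hinv : ∀ (Q : Type) [CommGroup Q] [Finite Q] (a : ℕ), (∀ q : Q, q ^ (ℓ ^ a) = 1) →
      ∀ (θ : Gamma M →* Q),
      (∀ (g x : SL(2, ℤ)) (hx : x ∈ Gamma M) (hgx : g * x * g⁻¹ ∈ Gamma M),
        θ ⟨g * x * g⁻¹, hgx⟩ = θ ⟨x, hx⟩) →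
      ∀ (x : SL(2, ℤ)) (hx : x ∈ Gamma M), x ∈ Gamma (12 * M) → θ ⟨x, hx⟩ = 1) :
    ∃ k : ℕ, ¬ ℓ ∣ k ∧ ∀ x : SL(2, ℤ), x ∈ Gamma (12 * M) → x ^ k ∈ ⁅(⊤ : Subgroup SL(2, ℤ)), Gamma M⁆ := by
  classical
  haveI : NeZero M := ⟨hM0⟩
  let K' : Subgroup (Gamma M) := (⁅(⊤ : Subgroup SL(2, ℤ)), Gamma M⁆).subgroupOf (Gamma M)
  obtain ⟨B, hinv0, hθ₀⟩ := exists_universal_invariant_hom M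
  let θ₀ : Gamma M →* Abelianization (Gamma M) ⧸ B := (QuotientGroup.mk' B).comp Abelianization.of
  have hsurj : Function.Surjective θ₀ :=
    (QuotientGroup.mk'_surjective B).comp QuotientGroup.mk_surjective
  haveI := finiteIndex_commutator_top_Gamma M
  have hK'fin : K'.index ≠ 0 := by
    intro h0
    have h := Subgroup.relIndex_mul_index
      (show ⁅(⊤ : Subgroup SL(2, ℤ)), Gamma M⁆ ≤ Gamma M from
        Subgroup.commutator_le_right _ _ (h := Gamma_normal M))
    rw [Subgroup.relIndex, show (⁅(⊤ : Subgroup SL(2, ℤ)), Gamma M⁆.subgroupOf (Gamma M)).index = 0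
      from h0, zero_mul] at h
    exact Subgroup.FiniteIndex.index_ne_zero h.symm
  have hker : θ₀.ker = K' := by
    ext x
    rw [MonoidHom.mem_ker, hθ₀, Subgroup.mem_subgroupOf]
  haveI : Finite (Abelianization (Gamma M) ⧸ B) := by
    have hcard : Nat.card (Abelianization (Gamma M) ⧸ B) = K'.index := by
      rw [← hker, Subgroup.index_ker, MonoidHom.range_eq_top.mpr hsurj, Subgroup.card_top]
    exact Nat.finite_of_card_ne_zero (hcard ▸ hK'fin)
  set n : ℕ := Nat.card (Abelianization (Gamma M) ⧸ B) with hn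
  set m : ℕ := ordCompl[ℓ] n with hm_def
  have hnm : ordProj[ℓ] n * m = n := Nat.ordProj_mul_ordCompl_eq_self n ℓ
  refine ⟨m, Nat.not_dvd_ordCompl hℓ Nat.card_pos.ne', fun x hx12 ↦ ?_⟩
  have hx : x ∈ Gamma M := Gamma_le_Gamma_of_dvd₁₂ (dvd_mul_left M 12) hx12
  -- corestriction of `θ₀^m` to the `ℓ`-power torsion
  have hpow : ∀ (y : Gamma M), ((powMonoidHom m).comp θ₀) y = θ₀ y ^ m := fun y ↦ rfl
  have he : ∀ y : Gamma M, ((powMonoidHom m).comp θ₀) y ^ (ℓ ^ n.factorization ℓ) = 1 := by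
    intro y
    rw [hpow, ← pow_mul, mul_comm, hnm, hn]
    exact pow_card_eq_one'
  set T : Subgroup (Abelianization (Gamma M) ⧸ B) :=
    (powMonoidHom (ℓ ^ n.factorization ℓ) : _ →* _).ker with hT
  set θT : Gamma M →* T := ((powMonoidHom m).comp θ₀).codRestrict T
    (fun y ↦ by rw [hT, MonoidHom.mem_ker, powMonoidHom_apply]; exact he y) with hθT
  have hθTval : ∀ y : Gamma M, ((θT y : T) : Abelianization (Gamma M) ⧸ B) = θ₀ y ^ m := fun y ↦ rfl
  have hQT : ∀ q : T, q ^ (ℓ ^ n.factorization ℓ) = 1 := by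
    intro q
    apply Subtype.ext
    have hq : (q : Abelianization (Gamma M) ⧸ B) ∈ (powMonoidHom (ℓ ^ n.factorization ℓ) : _ →* _).ker :=
      q.2
    rw [MonoidHom.mem_ker, powMonoidHom_apply] at hq
    rw [Subgroup.coe_pow, Subgroup.coe_one]
    exact hq
  have hθTinv : ∀ (g y : SL(2, ℤ)) (hy : y ∈ Gamma M) (hgy : g * y * g⁻¹ ∈ Gamma M),
      θT ⟨g * y * g⁻¹, hgy⟩ = θT ⟨y, hy⟩ := by
    intro g y hy hgy
    apply Subtype.ext
    rw [hθTval, hθTval, hinv0 g y hy hgy]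
  have h1 := hinv T (n.factorization ℓ) hQT θT hθTinv x hx hx12
  have h2 := congrArg Subtype.val h1
  rw [hθTval, Subgroup.coe_one, ← map_pow] at h2
  have h3 := (hθ₀ _).mp h2
  rwa [Subgroup.coe_pow] at h3

/-- **Targets of `ℓ`-power exponent, all levels with `4 ∤ N` (for `ℓ = 2`).**  Every
`SL₂(ℤ)`-conjugation-invariant `θ : Γ(N) → Q` is trivial on `Γ(12N)`.
[cite: CalegariDimitrovTang2025, Corollary 4.5.3] [cite: Beyl1986, Theorem] -/
theorem cor453_invariant_form_exponent_of_not_four_dvd {ℓ : ℕ} (hℓ : ℓ.Prime) :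
    ∀ {N : ℕ}, N ≠ 0 → (ℓ = 2 → ¬ 4 ∣ N) → ∀ (Q : Type) [CommGroup Q] [Finite Q] (a : ℕ),
      (∀ q : Q, q ^ (ℓ ^ a) = 1) → ∀ (θ : Gamma N →* Q),
      (∀ (g x : SL(2, ℤ)) (hx : x ∈ Gamma N) (hgx : g * x * g⁻¹ ∈ Gamma N),
        θ ⟨g * x * g⁻¹, hgx⟩ = θ ⟨x, hx⟩) →
      ∀ (x : SL(2, ℤ)) (hx : x ∈ Gamma N), x ∈ Gamma (12 * N) → θ ⟨x, hx⟩ = 1 := by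
  intro N
  induction N using Nat.strong_induction_on with
  | _ N ih =>
  intro hN0 h4 Q _ _ a hQ θ hθ x hx hx12
  by_cases hA : ∃ p : ℕ, p.Prime ∧ p ≠ ℓ ∧ p * p ∣ N
  · obtain ⟨p, hp, hpℓ, c, hc⟩ := hA
    have hc0 : c ≠ 0 := by rintro rfl; exact hN0 (by rw [hc, mul_zero])
    haveI : NeZero (p * c) := ⟨Nat.mul_ne_zero hp.ne_zero hc0⟩
    have hNM : N = p * c * p := by rw [hc]; ring
    have hMlt : p * c < N := by
      rw [hNM]
      exact lt_mul_of_one_lt_right (Nat.pos_of_ne_zero (NeZero.ne (p * c))) hp.one_lt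
    have h4M : ℓ = 2 → ¬ 4 ∣ p * c := fun h2 h ↦ h4 h2 (h.trans ⟨p, hNM⟩)
    have hcop : (ℓ ^ a).Coprime p := Nat.Coprime.pow_left a ((Nat.coprime_primes hℓ hp).mpr hpℓ.symm)
    have hM := fun (ψ : Gamma (p * c) →* Q) hψ ↦ ih (p * c) hMlt (NeZero.ne _) h4M Q a hQ ψ hψ
    refine transfer_step₄ (M₀ := 12 * (p * c)) hNM hp (dvd_mul_right p c) hcop hQ hM θ hθ x hx ?_
    exact Gamma_le_Gamma_of_dvd₁₂ (mul_dvd_mul_left 12 ⟨p, hNM⟩) hx12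
  · push Not at hA
    by_cases hcube : ℓ ^ 3 ∣ N
    · -- the depth step: `N = m ℓ^{v}` with `v ≥ 3`, `m` squarefree and prime to `ℓ`
      have hℓ2 : ℓ ≠ 2 := by
        rintro rfl
        exact h4 rfl (dvd_trans ⟨2, by norm_num⟩ hcube)
      set v : ℕ := N.factorization ℓ with hv
      set m : ℕ := ordCompl[ℓ] N with hm_def
      have hNm : N = m * ℓ ^ v := by
        rw [hm_def, hv, mul_comm]; exact (Nat.ordProj_mul_ordCompl_eq_self N ℓ).symm
      have hm0 : m ≠ 0 := by intro h; apply hN0; rw [hNm, h, zero_mul]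
      haveI : NeZero m := ⟨hm0⟩
      have hmℓ : m.Coprime ℓ := (Nat.coprime_ordCompl hℓ hN0).symm
      have hv3 : 3 ≤ v := by
        rw [hv]
        exact (Nat.Prime.pow_dvd_iff_le_factorization hℓ hN0).mp hcube
      obtain ⟨n, hn⟩ := Nat.exists_eq_add_of_le hv3
      have hvn : v = n + 1 + 2 := by rw [hn]; ring
      rw [hvn] at hNm
      -- the lower level `M = m ℓ^{n+2}` and the induction hypothesis there (all `ℓ`-power targets)
      have hM0 : m * ℓ ^ (n + 1 + 1) ≠ 0 := Nat.mul_ne_zero hm0 (pow_ne_zero _ hℓ.ne_zero)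
      have hNM : N = m * ℓ ^ (n + 1 + 1) * ℓ := by rw [hNm]; ring
      have hMlt : m * ℓ ^ (n + 1 + 1) < N := by
        rw [hNM]; exact lt_mul_of_one_lt_right (Nat.pos_of_ne_zero hM0) hℓ.one_lt
      have hIH : ∀ (Q' : Type) [CommGroup Q'] [Finite Q'] (a' : ℕ), (∀ q : Q', q ^ (ℓ ^ a') = 1) →
          ∀ (ψ : Gamma (m * ℓ ^ (n + 1 + 1)) →* Q'),
          (∀ (g y : SL(2, ℤ)) (hy : y ∈ Gamma (m * ℓ ^ (n + 1 + 1)))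
            (hgy : g * y * g⁻¹ ∈ Gamma (m * ℓ ^ (n + 1 + 1))), ψ ⟨g * y * g⁻¹, hgy⟩ = ψ ⟨y, hy⟩) →
          ∀ (y : SL(2, ℤ)) (hy : y ∈ Gamma (m * ℓ ^ (n + 1 + 1))), y ∈ Gamma (12 * (m * ℓ ^ (n + 1 + 1))) →
            ψ ⟨y, hy⟩ = 1 :=
        fun Q' _ _ a' hQ' ψ hψ ↦ ih _ hMlt hM0 (fun h ↦ absurd h hℓ2) Q' a' hQ' ψ hψ
      obtain ⟨k, hkℓ, hk⟩ := exists_pow_mem_commutator_of_forall hℓ hM0 hIH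
      -- `x^k ∈ [SL₂(ℤ), Γ(M)] ∩ Γ(N)` is killed by the depth step
      have hx12M : x ∈ Gamma (12 * (m * ℓ ^ (n + 1 + 1))) :=
        Gamma_le_Gamma_of_dvd₁₂ (mul_dvd_mul_left 12 ⟨ℓ, hNM⟩) hx12
      have hxk : x ^ k ∈ ⁅(⊤ : Subgroup SL(2, ℤ)), Gamma (m * ℓ ^ (n + 1 + 1))⁆ := hk x hx12M
      have he : ∀ y : Gamma N, θ y ^ (ℓ ^ a) = 1 := fun y ↦ hQ _
      have h1 : θ ⟨x ^ k, pow_mem hx k⟩ = 1 :=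
        top_layer' hNm hℓ hℓ2 hmℓ θ hθ he (x ^ k) (pow_mem hx k) (Subgroup.mem_sup_left hxk)
      have h2 : θ ⟨x, hx⟩ ^ k = 1 := by
        rw [← map_pow]; exact h1
      have hcop : Nat.Coprime k (ℓ ^ a) :=
        (Nat.Coprime.pow_left a ((Nat.Prime.coprime_iff_not_dvd hℓ).mpr hkℓ)).symm
      have h := pow_gcd_eq_one.mpr ⟨h2, hQ _⟩
      rwa [Nat.Coprime.gcd_eq_one hcop, pow_one] at h
    · -- `ℓ³ ∤ N`: the squarefree / `p²` levels
      by_cases hℓ2 : ℓ = 2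
      · subst hℓ2
        have hsq : ¬ 2 ^ 2 ∣ N := h4 rfl
        exact HcorTransfer.cor453_invariant_form_of_sq_not_dvd_exponent Nat.prime_two hN0 hsq Q hQ θ hθ x
          hx hx12
      · exact HcorPrimeSquare.cor453_invariant_form_of_cube_not_dvd_exponent hℓ hℓ2 hN0 hcube Q hQ θ hθ x
          hx hx12

/-- **The invariant form of CDT Cor. 4.5.3 for every level `N` with `4 ∤ N`**: for every finite
commutative `Q`, every `SL₂(ℤ)`-conjugation-invariant `θ : Γ(N) → Q` is trivial on `Γ(12N)`.
[cite: CalegariDimitrovTang2025, Corollary 4.5.3] [cite: Beyl1986, Theorem] -/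
theorem cor453_invariant_form_of_not_four_dvd {N : ℕ} (hN0 : N ≠ 0) (h4 : ¬ 4 ∣ N) (Q : Type)
    [CommGroup Q] [Finite Q] (θ : Gamma N →* Q)
    (hθ : ∀ (g x : SL(2, ℤ)) (hx : x ∈ Gamma N) (hgx : g * x * g⁻¹ ∈ Gamma N),
      θ ⟨g * x * g⁻¹, hgx⟩ = θ ⟨x, hx⟩) :
    ∀ (x : SL(2, ℤ)) (hx : x ∈ Gamma N), x ∈ Gamma (12 * N) → θ ⟨x, hx⟩ = 1 := by
  intro x hx hx12
  set n : ℕ := Nat.card Q with hn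
  have hn0 : n ≠ 0 := Nat.card_pos.ne'
  by_contra hne
  have hord : orderOf (θ ⟨x, hx⟩) ≠ 1 := fun h1 ↦ hne (orderOf_eq_one_iff.mp h1)
  obtain ⟨ℓ, hℓ, hℓq⟩ := Nat.exists_prime_and_dvd hord
  have hℓn : ℓ ∣ n := hℓq.trans (orderOf_dvd_of_pow_eq_one (hn ▸ pow_card_eq_one'))
  -- corestriction to the `ℓ`-power torsion
  set m : ℕ := ordCompl[ℓ] n with hm_def
  have hnm : ordProj[ℓ] n * m = n := Nat.ordProj_mul_ordCompl_eq_self n ℓ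
  have hpow : ∀ (y : Gamma N), ((powMonoidHom m).comp θ) y = θ y ^ m := fun y ↦ rfl
  have he : ∀ y : Gamma N, ((powMonoidHom m).comp θ) y ^ (ℓ ^ n.factorization ℓ) = 1 := by
    intro y
    rw [hpow, ← pow_mul, mul_comm, hnm, hn]
    exact pow_card_eq_one'
  set T : Subgroup Q := (powMonoidHom (ℓ ^ n.factorization ℓ) : Q →* Q).ker with hT
  set θT : Gamma N →* T := ((powMonoidHom m).comp θ).codRestrict T
    (fun y ↦ by rw [hT, MonoidHom.mem_ker, powMonoidHom_apply]; exact he y) with hθT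
  have hθTval : ∀ y : Gamma N, ((θT y : T) : Q) = θ y ^ m := fun y ↦ rfl
  have hQT : ∀ q : T, q ^ (ℓ ^ n.factorization ℓ) = 1 := by
    intro q
    apply Subtype.ext
    have hq : (q : Q) ∈ (powMonoidHom (ℓ ^ n.factorization ℓ) : Q →* Q).ker := q.2
    rw [MonoidHom.mem_ker, powMonoidHom_apply] at hq
    rw [Subgroup.coe_pow, Subgroup.coe_one]
    exact hq
  have hθTinv : ∀ (g y : SL(2, ℤ)) (hy : y ∈ Gamma N) (hgy : g * y * g⁻¹ ∈ Gamma N),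
      θT ⟨g * y * g⁻¹, hgy⟩ = θT ⟨y, hy⟩ := by
    intro g y hy hgy
    apply Subtype.ext
    rw [hθTval, hθTval, hθ g y hy hgy]
  have key : θ ⟨x, hx⟩ ^ m = 1 := by
    have h1 := cor453_invariant_form_exponent_of_not_four_dvd hℓ hN0 (fun _ ↦ h4) T (n.factorization ℓ) hQT
      θT hθTinv x hx hx12
    have h2 := congrArg Subtype.val h1
    rw [hθTval, Subgroup.coe_one] at h2
    exact h2
  have h1 : ℓ ∣ ordCompl[ℓ] n := hℓq.trans (orderOf_dvd_of_pow_eq_one key)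
  exact hℓ.one_lt.ne' (Nat.Coprime.eq_one_of_dvd (Nat.coprime_ordCompl hℓ hn0) h1)

/-- In the exact shape of `stub_hcor_invariant`, for every `N` with `4 ∤ N` (the case `N = 0` being trivial):
`M = 12N`.  K★ / Manin / BSD are NOT proved by this. [cite: CalegariDimitrovTang2025, Corollary 4.5.3] -/
theorem stub_hcor_invariant_of_not_four_dvd {N : ℕ} (hN0 : N ≠ 0) (h4 : ¬ 4 ∣ N) (Q : Type) [CommGroup Q]
    [Finite Q] (θ : Gamma N →* Q)
    (hθ : ∀ (g x : SL(2, ℤ)) (hx : x ∈ Gamma N) (hgx : g * x * g⁻¹ ∈ Gamma N),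
      θ ⟨g * x * g⁻¹, hgx⟩ = θ ⟨x, hx⟩) :
    ∃ M : ℕ, M ≠ 0 ∧ ∀ (x : SL(2, ℤ)) (hx : x ∈ Gamma N), x ∈ Gamma M → θ ⟨x, hx⟩ = 1 :=
  ⟨12 * N, Nat.mul_ne_zero (by norm_num) hN0, cor453_invariant_form_of_not_four_dvd hN0 h4 Q θ hθ⟩

/-- **`Γ(12N) ≤ [SL₂(ℤ), Γ(N)]` for every `N ≥ 1` with `4 ∤ N`** (Beyl's exact level is `lcm(N, 12)`).
[cite: Beyl1986, Theorem] [cite: CalegariDimitrovTang2025, Corollary 4.5.3] -/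
theorem Gamma_mul_le_commutator_of_not_four_dvd {N : ℕ} (hN0 : N ≠ 0) (h4 : ¬ 4 ∣ N) :
    Gamma (12 * N) ≤ ⁅(⊤ : Subgroup SL(2, ℤ)), Gamma N⁆ := by
  classical
  haveI : NeZero N := ⟨hN0⟩
  let K' : Subgroup (Gamma N) := (⁅(⊤ : Subgroup SL(2, ℤ)), Gamma N⁆).subgroupOf (Gamma N)
  obtain ⟨B, hinv0, hθ₀⟩ := exists_universal_invariant_hom N
  let θ₀ : Gamma N →* Abelianization (Gamma N) ⧸ B := (QuotientGroup.mk' B).comp Abelianization.of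
  have hsurj : Function.Surjective θ₀ :=
    (QuotientGroup.mk'_surjective B).comp QuotientGroup.mk_surjective
  haveI := finiteIndex_commutator_top_Gamma N
  have hK'fin : K'.index ≠ 0 := by
    intro h0
    have h := Subgroup.relIndex_mul_index
      (show ⁅(⊤ : Subgroup SL(2, ℤ)), Gamma N⁆ ≤ Gamma N from
        Subgroup.commutator_le_right _ _ (h := Gamma_normal N))
    rw [Subgroup.relIndex, show (⁅(⊤ : Subgroup SL(2, ℤ)), Gamma N⁆.subgroupOf (Gamma N)).index = 0
      from h0, zero_mul] at h
    exact Subgroup.FiniteIndex.index_ne_zero h.symm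
  have hker : θ₀.ker = K' := by
    ext x
    rw [MonoidHom.mem_ker, hθ₀, Subgroup.mem_subgroupOf]
  haveI : Finite (Abelianization (Gamma N) ⧸ B) := by
    have hcard : Nat.card (Abelianization (Gamma N) ⧸ B) = K'.index := by
      rw [← hker, Subgroup.index_ker, MonoidHom.range_eq_top.mpr hsurj, Subgroup.card_top]
    exact Nat.finite_of_card_ne_zero (hcard ▸ hK'fin)
  intro x hx12
  have hx : x ∈ Gamma N := Gamma_le_Gamma_of_dvd₁₂ (dvd_mul_left N 12) hx12
  exact (hθ₀ ⟨x, hx⟩).mp (cor453_invariant_form_of_not_four_dvd hN0 h4 _ θ₀ hinv0 x hx hx12)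

end HcorPrimePow

end Summit.BirchSwinnertonDyer.BirchSwinnertonDyer.Theorems
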